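import Summits.Schanuel.Schanuel.Theorems.RootDecomp1KSkelCell10

/-!
# RootDecomp1KDegreeLadder — lens 1, generation 45 «DEGREE LADDER AT FIXED SKEL-QUALITY (DL) + THIN-FIBRE RESIDUAL» (lane K-R30 (b); CLAIM L2155, ACK/CHECKLIST K-g45 L2159, NODE L2213 / REQUEST L2214, writer re-checks L2219/L2221/L2230, critic VERDICT L2216: CLEARED — THEOREM ×1 for DL `degreeLadder`; EDITION 2/3 docstring-only accepted L2224 / files of record L2228 (K ed. 3 f2af863f…); RULE K-R31; lens-1 tally credits ×11 + THEOREM ×2) — part 1 (RootDecomp1KDegreeLadder01): K doc + §0 residue + §1 toolkit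

(lens-1 g45 HOME kernel K = HOME/decomp-schanuel-lens-1/g45/DegreeLadder.lean EDITION 3 f2af863f…, 2183 l, imports tree `…RootDecomp1KSkelCell01` (the tree now has `…SkelCell10` with §8's `SkelLiouvilleFix`); P DLprobe.lean f44a49e4… rc 0, C DLctrl.lean 394594cd… rc 1 = exactly the 13 planted errors. Port by census-1 gen 19 as `RootDecomp1KDegreeLadder01`–`08` (+ `09` deferred): 01 = K's module doc + §0 residue (`skelLiouvilleFix_of_skelLiouville`, `SkelLiouvilleFix.liouville` / `.transcendental` declared in the TREE namespace `…RootDecomp1KSkelCell` so dot-notation keeps working) + §1 toolkit `bev`/`xdeg`/`dX`/`specX`; 02 = §2 truncations + §3 calculus (`tangent`, Lipschitz, `coeff_specX_bound`); 03 = §4 engine A (`onCurve_exponent_ineq`, `engine_core`); 04 = §4 engine B (`lowDegree_clause`, `engine_of_clause`, `engine`) + §5 THE DEGREE LADDER `degreeLadder (d) (ρ) (hρ : SkelLiouvilleFix (d + 1) ρ) (P : ℤ[X][X]) (hP : P ≠ 0) (hdeg : P.natDegree ≤ d) : bev P (liouvilleNumber 2) ρ ≠ 0` (descent `no_relation_of_engine`);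 05 = §5b limit corollary (`algebraicIndependent_of_forall_fix`) + §5c relative degree (`relDegree_gt`, `skelFix_two_not_mem_adjoin(_complex)`); 06 = §5d the residual `ThinFibre`/`ThinFibreAt` (+ glue `thinFibre_imp_b`) + §6 the toy fibre decided (`sq_fibre_iff`, `toy_clause`); 07 = §7 tightness at d = 1 (`degreeLadder_tight_one`, `rU_injective`, `not_thinFibre_one`, `not_thinFibre_zero`); 08 = §8a the 2-adic mechanism (`two_adic_split`, `two_adic_quality`, hypothesis-free); 09 (DEFERRED until Literature `…DiophantineApproximation.RidoutIntegers` builds on the check farm, rc 75 today) = §8b `isSquare_mul_psNumer_finite`, `isSquare_seventeen_mul_psNumer_finite`, `thinFibreAt_sqMulP` with `Ridout.padicRoth_int` BY NAME (K carries them under a `(hR : PadicRothInt)` binder whose `def` is NOT landed — verdict condition (c)).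
PORT EDITS: import `…SkelCell10` instead of `…SkelCell01` and DELETE K's verbatim copies of the tree's §8 (`SkelLiouvilleFix`, `skelLiouville_iff_fix`, `SkelLiouvilleFix.mono`, `uStar`, `dU`, `rU`, `dU_cast`, `two_pow_le_four_mul_dU`, `two_mul_dU_lt`, `one_le_dU`, `rU_den`, `rU_cast`, `uStar_sub_rU`, `skelLiouvilleFix_one_uStar`, `not_skelFixOne_algebraicIndependent` — 15 blocks, opened from `…RootDecomp1KSkelCell` by name; verdict condition (a)); the file-wide linter option dropped (b); 58 one-line docstrings added to undocumented helper lemmas; 34 small generic ℓ₂/`psNumer`/`partialSum`/cast lemmas made PRIVATE (dedup-safety against tree twins in TwoBaseCell/CommonRadixCell/SkelCell/RadixCell) with per-part private copies; `ThinFibre`/`ThinFibreAt` docstrings carry the residual-class tag (d); graded statements and proofs otherwise verbatim. `--supports stmt-Schanuel-33364`; no census credit carried; rung 0 — nothing here proves Schanuel, `FiniteOrderLiouvilleSchanuel` (33364), `CoordLiouvilleSchanuel` (31077) or (b) at fixed quality.)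
-/

/-!
# RootDecomp1KDegreeLadder — lens 1, generation 45 «DEGREE LADDER AT FIXED SKEL-QUALITY (DL)»

(lens-1 g45 HOME kernel `DegreeLadder.lean`; CLAIM L2155, ACK L2159 = CHECKLIST K-g45 (1)–(8); imports the tree
module `RootDecomp1KSkelCell01` (`iota`, `SkelLiouville`) and, through it, `RootDecomp1KTwoBaseCell03/06`
(`algebraicIndependent_of_forall_int'`, `psNumer`, `coprime_psNumer`) and `RootDecomp1KRelLiouvilleCell03`
(`partialSum` facts); proposed port name `RootDecomp1KDegreeLadder01–0k --supports stmt-Schanuel-33364`; rung 0 —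
NOTHING here proves `Schanuel`, `FiniteOrderLiouvilleSchanuel` (33364), `CoordLiouvilleSchanuel` (31077) or the
fixed-quality statement (b); the class `SkelLiouvilleFix` is the TEXT of g44 K §8 (tree port part 10 pending) and is
to be replaced by the tree name at port.)

## THE THEOREM (hypothesis-free, exact, every `d`, uniform in the `x`-degree `k` and in the height)

`degreeLadder (d : ℕ) (ρ : ℝ) (hρ : SkelLiouvilleFix (d + 1) ρ) (P : ℤ[X][X]) (hP : P ≠ 0)
   (hdeg : P.natDegree ≤ d) : bev P (liouvilleNumber 2) ρ ≠ 0`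

(`ℤ[X][X]` = `ℤ[x][Y]`, outer variable `Y ↦ ρ`, inner `C X ↦ ℓ₂ := liouvilleNumber 2 = Σ 2^{−n!}`,
`bev P x y` the evaluation; `SkelLiouvilleFix m ρ := ∀ q₀, ∃ r : ℚ, q₀ ≤ den r ∧ ρ ≠ r ∧ |ρ − r| < den r^{−m·ι(den r)}`
with the tree's `ι(q) = iota q = min {n : q ≤ 2^{n!}}`).  A real in the fixed-multiple class `Skel₍d+1₎` satisfies NO
integer relation `P(ℓ₂, ρ) = 0` of `Y`-degree `≤ d` — whatever its `x`-degree and coefficients.  Rungs: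
`d = 1`: `Skel₍₂₎ ∋ ρ ⇒ ρ ∉ ℚ(ℓ₂)` (`skelFix_two_not_mem_adjoin`); general `d`: no `p ∈ ℚ(ℓ₂)[Y]`, `p ≠ 0`,
`deg p ≤ d` with `p(ρ) = 0`, i.e. `[ℚ(ℓ₂)(ρ) : ℚ(ℓ₂)] > d` (`relDegree_gt`); `d → ∞`: `ρ ∈ ⋂ₘ Skel₍ₘ₎ ⇒ (ℓ₂, ρ)`
algebraically independent over `ℚ` (`algebraicIndependent_of_forall_fix`, `…_of_skelLiouville`) — the g44 pair cell
re-derived with NO transcendence measure of `ℓ₂` and no height bookkeeping.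

## THE ENGINE (§3–§4, named lemmas) and the exchange rate `m = d + 1`

Suppose `P(ℓ₂, ρ) = 0`, `Y`-degree `d ≥ 1`, and (after the minimal-`x`-degree DESCENT `no_relation_of_engine`,
which replaces `P` by `∂P/∂x` as long as that still vanishes — `xdeg` drops, `Y`-degree does not grow, and an
`x`-free relation is impossible since `ρ` is transcendental) `∂P/∂x (ℓ₂, ρ) ≠ 0`.  Take a Skel-approximant `r`,
`q = den r` huge, and the LEVEL `N := ι(q^{2d}) − 1`, i.e. `2^{N!} < q^{2d} ≤ 2^{(N+1)!}` (`iota_spec`,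
`pow_lt_of_lt_iota`).  DICHOTOMY at the truncation `s_N = p_N / 2^{N!}` (`partialSum_two`, `coprime_psNumer_two_pow`):
* OFF the curve, `P(s_N, r) ≠ 0`: integrality `|q^d P(s_N, r)| ≥ 2^{−k·N!}` (`abs_aeval_ge_of_ne_zero` on
  `specX P r = q^d P(·, r) ∈ ℤ[x]`) against `q^d (|P(s_N,r) − P(ℓ₂,r)| + |P(ℓ₂,r) − P(ℓ₂,ρ)|) ≤ q^d (2C₆ 2^{−(N+1)!} + C₂ q^{−m ι(q)})`
  (`lipschitz_x`, `lipschitz_y`); the `2`-half is `≤ ½·2^{−kN!}` because `q^d ≤ 2^{(N+1)!/2}` and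
  `kN! + (N+1)!/2 + L ≤ (N+1)!` for `N ≥ 2k + 1` — THIS is where the `x`-degree `k` is absorbed: by the growth
  `(N+1)!/N! = N + 1` of the level, not by `m` —, the `q`-half because `2^{kN!} < q^{2dk}` and `m ι(q) ≥ 1 + d + 2dk + L`
  for ANY `m ≥ 1` once `ι(q)` is large.  Contradiction: `engine_core` (valid for every `m ≥ 1`).
* ON the curve, `P(s_N, r) = 0`: the TANGENT `|P(ℓ₂, r)| = |P(ℓ₂,r) − P(s_N,r)| ≥ (|∂ₓP(ℓ₂,ρ)|/2)(ℓ₂ − s_N) ≥ τ₀ 2^{−(N+1)!}`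
  (`tangent`, `le_remainder_two`) against `|P(ℓ₂, r)| = |P(ℓ₂,r) − P(ℓ₂,ρ)| ≤ C₂ q^{−m ι(q)} ≤ C₂ q^{−mN}` gives the
  EXCHANGE INEQUALITY  `q^{m·N} < (C₂/τ₀) · 2^{(N+1)!}`  (★) (`engine_core`, conclusion), and GAUSS — `s_N` in lowest
  terms is a root of `q^d P(x, r) ∈ ℤ[x]`, so `2^{N!} ∣` its leading coefficient, `2^{N!} ≤ C₃ q^d`
  (`le_abs_leadingCoeff_of_root`, `coeff_specX_bound_abs`) — gives `q ≳ 2^{N!/d}`.  Together: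
  `2^{N!·(d+1)N} ≤ (C₃ q^d)^{(d+1)N} < C₃^{(d+1)N} C^d 2^{(N+1)!·d} ≤ 2^{L((d+1)N + d) + (N+1)!·d}`, i.e. at `m = d + 1`
  the rate `m/d > (N+1)/N` beats `(N+1)! = (N+1)·N!`; `onCurve_exponent_ineq` is the closing integer inequality
  `L((d+1)N) + Ld + (N+1)!·d ≤ N!·(d+1)N` for `N ≥ L(2d+1) + d + 1`.  Packaged: `lowDegree_clause` (the Gauss half IS the
  thin-fibre clause of §5d for `Y`-degree `< m`), `engine_of_clause` (core + clause ⇒ contradiction), `engine`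
  (`= engine_of_clause` with `lowDegree_clause` at `m = d + 1`).  The `x`-degree never
  enters the on-curve branch; the height enters only the constants `C₂, C₆, τ₀, C₃, L`, which the level outgrows.

## NOVELTY versus g44 (`RootDecomp1KSkelCell`, engine `no_int_relation_of_skelMeasure_skelLiouville`)

g44 refutes `P(ℓ₂, ρ) = 0` for `ρ ∈ Skel = ⋂ₘ Skel₍ₘ₎` by consuming the multiple
`m_g44 := ⌈3·Cst·c₁⌉₊ + K + ⌈M⌉₊ + 1`, `Cst = 2C₁ + τ + d(τ+1)A₀ + 1`, `c₁ = 1 + log C_q + K` (K = total degree,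
M from the Skel-MEASURE of `ℓ₂`): `m_g44 ≥ d + 2` and it GROWS with the `x`-degree and the logarithmic height.  DL fixes
`m = d + 1` once and for all, uses no transcendence / Skel measure of `ℓ₂` at all (only `s_N → ℓ₂` at speed
`2^{−(N+1)!}` and `gcd(p_N, 2) = 1`), and is uniform in `k` and the height.  New ingredients: the level dichotomy, the
tangent transversality after `∂/∂x`-descent, and Gauss on the `x`-side.

## TIGHTNESS, THIN FIBRES, THE TOY (§5d, §6, §7)

* `degreeLadder_tight_one`: at `d = 1` the rung `m = 2` cannot be lowered — `u⋆ = 1/(ℓ₂ − 1) ∈ Skel₍₁₎`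
  (`skelLiouvilleFix_one_uStar`) lies on the line `(x − 1)Y = 1`; `not_skelFixOne_algebraicIndependent`.  Sharpness of
  `m = d + 1` for `d ≥ 2`: OPEN.
* `ThinFibre m₀` (§5d): for every `P ≠ 0` and `C`, beyond some level every NON-DEGENERATE rational point `r` (`P(·,r) ≢ 0`),
  `|r| ≤ C`, ON a level curve `P(s_N, ·) = 0` has `den(r)^{m₀ N} > C 2^{(N+1)!}` (the two provisos are forced by the
  trivial witnesses `P = (4x − 5)·Y`, `P = Y − 3`).  GLUE PROVED: `thinFibre_imp_b : 1 ≤ m₀ → ThinFibre m₀ → ∀ ρ ∈ Skel₍m₀₎,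
  (ℓ₂, ρ)` a.i. (`engine_thin = engine_of_clause`; every `Y`-degree).  STRUCTURE PROVED: the clause holds for free in
  `Y`-degree `< m₀` (`thinFibreAt_of_natDegree_lt`, `thinFibre_iff_high`: `ThinFibre m₀` ⟺ its clause for the curves of
  `Y`-degree `≥ m₀`), `ThinFibre.mono`, `not_thinFibre_one`/`not_thinFibre_zero`: `ThinFibre 1`, `ThinFibre 0` are FALSE
  (the line through `u⋆`).  `ThinFibre m₀` for some `m₀ ≥ 2` is UNDECIDED here (leaf IDEA-NEEDED, see NODE-g45.md: it asks
  for NO sporadic rational points of height `≈ 2^{N!/m₀}` on the curves `P(s_N, y) = 0` of `Y`-degree `≥ m₀` at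
  infinitely many levels; its first printed instance `Y² = 17x`, `m₀ = 2`: «`17·p_N` is a square for only finitely many
  `N`» is DECIDED in §8, so a failure of `ThinFibre 2` must come from curves outside the family `Y² = c·x`).
* THE PRINTED LEAF INSTANCE DECIDED (§8, 2-adically): `p_N → 1` in `ℤ₂` (`p_{M+1} = 2^{M·M!} p_M + 1`), so
  `y² = c·p_{M+1}` (`c` odd) makes `y` an integer approximation of exponent `→ 2` to a 2-adic `√c`
  (`two_adic_split`, `two_adic_quality`); Ridout's `p`-adic Roth theorem for integers — PROVED in the tree as
  `Literature.NumberTheory.DiophantineApproximation.Ridout.padicRoth_int`, entering here as the hypothesis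
  `hR : PadicRothInt` (its statement verbatim; the farm snapshot of this session has that module unbuilt) — gives
  `isSquare_mul_psNumer_finite hR : {N | IsSquare (c·psNumer 2 N)}.Finite` for every odd `c`
  (`isSquare_seventeen_mul_psNumer_finite`), and `thinFibreAt_sqMulP hR : ∀ m₀, ThinFibreAt m₀ (Y² − c·x)`.
* TOY `y² = x` DECIDED (§6): `sq_fibre_iff : (∃ a : ℚ, a² = p_N/2^{N!}) ↔ N = 1 ∨ N = 3` (all `N`; the 2-adic
  obstruction `no_odd_square_near`), `toy_branch_contributes_nothing`: the on-curve set of `Y² − x` over all levels is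
  `⊆ {±1, ±9/8}`, and `toy_clause : ∀ m₀, ThinFibreAt m₀ toyP` — the clause holds for this `P` at every `m₀`.
-/

noncomputable section

open Polynomial LiouvilleNumber
open scoped Nat

namespace Summit.Schanuel.Schanuel.Theorems.RootDecomp1KDegreeLadder

open Summit.Schanuel.Schanuel.Theorems.RootDecomp1KSkelCell
  (exists_le_two_pow_factorial iota iota_spec iota_le_of_le pow_lt_of_lt_iota lt_iota_of_pow_lt iota_mono
   one_le_iota SkelLiouville SkelLiouvilleFix skelLiouville_iff_fix SkelLiouvilleFix.mono uStar dU rU dU_cast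
   two_pow_le_four_mul_dU two_mul_dU_lt one_le_dU rU_den rU_cast uStar_sub_rU skelLiouvilleFix_one_uStar
   not_skelFixOne_algebraicIndependent)
open Summit.Schanuel.Schanuel.Theorems.RootDecomp1KTwoBaseCell (psNumer partialSum_eq_psNumer_div coprime_psNumer
  algebraicIndependent_of_forall_int')
open Summit.Schanuel.Schanuel.Theorems.RootDecomp1KRelLiouvilleCell (partialSum_two_strictMono
  partialSum_two_lt_liouvilleNumber abs_liouvilleNumber_two_sub_partialSum)

/-! ## §0  The fixed-multiple class `Skel₍ₘ₎` (text verbatim = g44 K §8 `RootDecomp1KSkelCell.SkelLiouvilleFix`;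
tree port of that § pending — census dedups at port) -/

section FixedClass

/-- `Skel ⊆ Skel₍ₘ₎` for every `m` (the direction of `skelLiouville_iff_fix` we use). -/
theorem skelLiouvilleFix_of_skelLiouville {ρ : ℝ} (h : SkelLiouville ρ) (m : ℕ) :
    SkelLiouvilleFix m ρ := by
  intro q₀
  obtain ⟨r, hden, hne, hlt⟩ := h (max m q₀)
  refine ⟨r, le_trans (le_max_right _ _) hden, hne, hlt.trans_le ?_⟩
  have h1 : (1 : ℝ) ≤ r.den := by exact_mod_cast r.den_pos
  exact one_div_le_one_div_of_le (by positivity)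
    (pow_le_pow_right₀ h1 (Nat.mul_le_mul_right _ (le_max_left _ _)))

/-- `Skel₍ₘ₎ ⊆ Liouville` for `m ≥ 1` (so every `ρ ∈ Skel₍ₘ₎` is transcendental). -/
theorem _root_.Summit.Schanuel.Schanuel.Theorems.RootDecomp1KSkelCell.SkelLiouvilleFix.liouville {m : ℕ} (hm : 1 ≤ m)
    {ρ : ℝ} (hρ : SkelLiouvilleFix m ρ) :
    Liouville ρ := by
  intro n
  obtain ⟨r, hden, hne, hlt⟩ := hρ (2 ^ n ! + 3)
  have h3 : 3 ≤ r.den := le_trans (Nat.le_add_left 3 _) hden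
  have hι : n < iota r.den :=
    lt_iota_of_pow_lt (lt_of_lt_of_le (Nat.lt_add_of_pos_right (by norm_num)) hden)
  have hn : n ≤ m * iota r.den := le_trans hι.le (Nat.le_mul_of_pos_left _ hm)
  have hden1 : (1 : ℝ) < r.den := by exact_mod_cast (show 1 < r.den by omega)
  refine ⟨r.num, r.den, by exact_mod_cast (show 1 < r.den by omega), ?_, ?_⟩
  · intro h
    apply hne
    rw [h, Rat.cast_def]
    push_cast
    rfl
  · have e : ((r.num : ℤ) : ℝ) / (((r.den : ℕ) : ℤ) : ℝ) = (r : ℝ) := by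
      rw [Rat.cast_def]; push_cast; rfl
    rw [e]
    have e2 : (1 : ℝ) / (((r.den : ℕ) : ℤ) : ℝ) ^ n = 1 / (r.den : ℝ) ^ n := by push_cast; rfl
    rw [e2]
    refine hlt.trans_le ?_
    exact one_div_le_one_div_of_le (by positivity) (pow_le_pow_right₀ hden1.le hn)

/-- `Skel₍ₘ₎`-reals (`m ≥ 1`) are transcendental (over `ℤ`). -/
theorem _root_.Summit.Schanuel.Schanuel.Theorems.RootDecomp1KSkelCell.SkelLiouvilleFix.transcendental {m : ℕ}
    (hm : 1 ≤ m) {ρ : ℝ} (hρ : SkelLiouvilleFix m ρ) :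
    Transcendental ℤ ρ :=
  (hρ.liouville hm).transcendental

end FixedClass

/-! ## §1  Toolkit for `ℤ[X][X]` (outer variable `Y ↦ ρ`, inner variable `X ↦ ℓ₂`) -/

section Toolkit

/-- Two-variable evaluation of `P ∈ ℤ[X][X]` at a real point `(x, y)`. -/
def bev (P : ℤ[X][X]) (x y : ℝ) : ℝ := (P.map (aeval x : ℤ[X] →ₐ[ℤ] ℝ).toRingHom).eval y

/-- `bev` is multiplicative. -/
@[simp] theorem bev_mul (P Q : ℤ[X][X]) (x y : ℝ) : bev (P * Q) x y = bev P x y * bev Q x y := by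
  simp [bev, Polynomial.map_mul, eval_mul]

/-- `bev` is additive. -/
@[simp] theorem bev_add (P Q : ℤ[X][X]) (x y : ℝ) : bev (P + Q) x y = bev P x y + bev Q x y := by
  simp [bev, Polynomial.map_add, eval_add]

/-- `bev` of a constant (in `Y`) is the inner evaluation at `x`. -/
@[simp] theorem bev_C (c : ℤ[X]) (x y : ℝ) : bev (C c) x y = aeval x c := by
  simp [bev]

/-- `bev` of the outer variable `Y` is `y`. -/
@[simp] theorem bev_X (x y : ℝ) : bev (X : ℤ[X][X]) x y = y := by
  simp [bev]

/-- `bev` as an explicit finite sum over the `Y`-coefficients. -/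
theorem bev_eq_sum (P : ℤ[X][X]) {n : ℕ} (hn : P.natDegree < n) (x y : ℝ) :
    bev P x y = ∑ j ∈ Finset.range n, aeval x (P.coeff j) * y ^ j := by
  unfold bev
  have hdeg : (P.map (aeval x : ℤ[X] →ₐ[ℤ] ℝ).toRingHom).natDegree < n :=
    lt_of_le_of_lt (natDegree_map_le) hn
  rw [eval_eq_sum_range' hdeg]
  simp [coeff_map]

/-- The `x`-degree of `P ∈ ℤ[X][X]`: the largest degree of a `Y`-coefficient. -/
def xdeg (P : ℤ[X][X]) : ℕ := (Finset.range (P.natDegree + 1)).sup fun j => (P.coeff j).natDegree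

/-- Every `Y`-coefficient has `x`-degree at most `xdeg P`. -/
theorem natDegree_coeff_le_xdeg (P : ℤ[X][X]) (j : ℕ) : (P.coeff j).natDegree ≤ xdeg P := by
  by_cases hj : j ≤ P.natDegree
  · exact Finset.le_sup (f := fun j => (P.coeff j).natDegree) (Finset.mem_range.mpr (by omega))
  · rw [coeff_eq_zero_of_natDegree_lt (by omega)]
    simp

/-- Coefficientwise `d/dx`. -/
def dX (P : ℤ[X][X]) : ℤ[X][X] :=
  ∑ j ∈ Finset.range (P.natDegree + 1), monomial j (derivative (P.coeff j))

/-- The `Y`-coefficients of `dX P` are the `x`-derivatives of those of `P`. -/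
theorem coeff_dX (P : ℤ[X][X]) (j : ℕ) : (dX P).coeff j = derivative (P.coeff j) := by
  unfold dX
  rw [finsetSum_coeff]
  simp only [coeff_monomial]
  rw [Finset.sum_ite_eq']
  split_ifs with h
  · rfl
  · rw [coeff_eq_zero_of_natDegree_lt (by simpa using h)]
    simp

/-- `dX` does not raise the `Y`-degree. -/
theorem natDegree_dX_le (P : ℤ[X][X]) : (dX P).natDegree ≤ P.natDegree := by
  unfold dX
  refine (natDegree_sum_le _ _).trans ?_
  refine Finset.sup_le fun j hj => ?_
  exact (natDegree_monomial_le _).trans (by have := Finset.mem_range.mp hj; omega)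

/-- `dX` lowers the `x`-degree (when it is positive). -/
theorem xdeg_dX_lt {P : ℤ[X][X]} (hP : 1 ≤ xdeg P) : xdeg (dX P) < xdeg P := by
  have key : ∀ j, ((dX P).coeff j).natDegree < xdeg P := by
    intro j
    rw [coeff_dX]
    have hj := natDegree_coeff_le_xdeg P j
    by_cases h0 : (P.coeff j).natDegree = 0
    · have hz : derivative (P.coeff j) = 0 := by rw [eq_C_of_natDegree_eq_zero h0, derivative_C]
      rw [hz, natDegree_zero]
      exact Nat.lt_of_lt_of_le Nat.zero_lt_one hP
    · exact lt_of_le_of_lt (natDegree_derivative_le _) (by omega)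
  show (Finset.range ((dX P).natDegree + 1)).sup (fun j => ((dX P).coeff j).natDegree) < xdeg P
  exact (Finset.sup_lt_iff (by rw [bot_eq_zero]; exact hP)).mpr fun j _ => key j

/-- `dX P ≠ 0` when `P` has positive `x`-degree. -/
theorem dX_ne_zero {P : ℤ[X][X]} (hP : 1 ≤ xdeg P) : dX P ≠ 0 := by
  -- some coefficient has positive degree, hence non-zero derivative
  obtain ⟨j, hj⟩ : ∃ j, 1 ≤ (P.coeff j).natDegree := by
    by_contra h
    push Not at h
    have h0 : xdeg P ≤ 0 := by
      show (Finset.range (P.natDegree + 1)).sup (fun j => (P.coeff j).natDegree) ≤ 0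
      exact Finset.sup_le fun j _ => by have := h j; omega
    omega
  intro h0
  have hc : (dX P).coeff j = 0 := by rw [h0, coeff_zero]
  rw [coeff_dX] at hc
  have := derivative_eq_zero.mp hc
  omega

/-- `xdeg P = 0`: all `Y`-coefficients are constants, so `P(x, y)` does not depend on `x` and
`ρ ↦ P(x, ρ)` is an integer polynomial relation. -/
theorem bev_eq_aeval_of_xdeg_eq_zero {P : ℤ[X][X]} (hP : xdeg P = 0) (x y : ℝ) :
    bev P x y = aeval y (∑ j ∈ Finset.range (P.natDegree + 1), C ((P.coeff j).coeff 0) * X ^ j : ℤ[X]) := by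
  rw [bev_eq_sum P (Nat.lt_succ_self _)]
  rw [map_sum]
  refine Finset.sum_congr rfl fun j _ => ?_
  have h0 : (P.coeff j).natDegree = 0 := by
    have := natDegree_coeff_le_xdeg P j; omega
  rw [eq_C_of_natDegree_eq_zero h0]
  simp

/-- The specialisation `Y ↦ r = a/q`, cleared: `specX P r = Σ_j P_j(X)·a^j·q^{d−j} = q^d·P(X, r)`, `d = natDegree P`. -/
def specX (P : ℤ[X][X]) (r : ℚ) : ℤ[X] :=
  ∑ j ∈ Finset.range (P.natDegree + 1), P.coeff j * C (r.num ^ j * (r.den : ℤ) ^ (P.natDegree - j))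

/-- The specialisation `specX P r` has degree at most `xdeg P`. -/
theorem natDegree_specX_le (P : ℤ[X][X]) (r : ℚ) : (specX P r).natDegree ≤ xdeg P := by
  unfold specX
  refine (natDegree_sum_le _ _).trans (Finset.sup_le fun j _ => ?_)
  exact (natDegree_mul_C_le _ _).trans (natDegree_coeff_le_xdeg P j)

/-- `specX P r` evaluated at `x` is `q^d · P(x, r)`. -/
theorem aeval_specX (P : ℤ[X][X]) (r : ℚ) (x : ℝ) :
    aeval x (specX P r) = (r.den : ℝ) ^ P.natDegree * bev P x r := by
  unfold specX
  rw [bev_eq_sum P (Nat.lt_succ_self _), map_sum, Finset.mul_sum]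
  refine Finset.sum_congr rfl fun j hj => ?_
  have hj' : j ≤ P.natDegree := by have := Finset.mem_range.mp hj; omega
  rw [map_mul, aeval_C]
  have hq : (r.den : ℝ) ≠ 0 := by exact_mod_cast r.den_nz
  have er : (r : ℝ) = (r.num : ℝ) / (r.den : ℝ) := by rw [Rat.cast_def]
  rw [er, div_pow]
  simp only [algebraMap_int_eq, eq_intCast, Int.cast_mul, Int.cast_pow, Int.cast_natCast]
  rw [← pow_sub_mul_pow (r.den : ℝ) hj']
  field_simp

end Toolkit

end Summit.Schanuel.Schanuel.Theorems.RootDecomp1KDegreeLadder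

end
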